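import Literature.Computability.Complexity.Hastad3SatReduction
import Literature.Computability.Complexity.ApproximationProofs
import HarnessLib

/-!
# The PCP theorem in gap-E3SAT form holds; Håstad's `7/8 + ε` theorem from Håstad machines alone

Topic `Computability/Complexity`; PROOF file (theorems only: no definition, no named fact) under the
named fact `Literature.Computability.Complexity.hastad_seven_eighths` (`Approximation.lean`;
J. Håstad, *Some optimal inapproximability results*, J. ACM 48 (2001), Thm. 6.5: for every `ε > 0` the
promise problem `gapE3SAT ε` is NP-hard).

The printed proof has two parts of different nature, mirrored by the tree's shell
`hastad_seven_eighths_of_machines` (`Hastad3SatReduction.lean`):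

1. **The PCP theorem in gap form** (Håstad 2001, Thm. 2.24, after Arora–Lund–Motwani–Sudan–Szegedy;
   Arora–Barak 2009, Thm. 11.9 with §22.2): for SOME constant `ε₀ < 1/8` the problem `gapE3SAT ε₀`
   is NP-hard.  This is a THEOREM of the tree, recorded here as `gapE3SAT_isNPHard_some`: Dinur's gap
   amplification on the Gabber–Galil kit, placed in `FP` through Cobham's class, is the gap machine
   `GapPV.ggMachine : GapMachine (ε₁Q ggP)` (`ApproximationProofs.lean`, which also discharges
   `pcp_theorem_exact`), and `gapE3SAT_isNPHard_of_gapMachine` (`GapAssembly.lean`) turns it into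
   NP-hardness of `gapE3SAT (1/8 - ε₁Q ggP)`.
2. **Håstad's gap amplification** (the proof of Thm. 6.5 proper: the two-prover protocol on a
   `c`-satisfiable E3-CNF and its `u`-fold parallel repetition, §2 with Raz's theorem; the 3-query
   test `F3S^δ(u)` on long codes and its Fourier analysis, §6.1, Lemmas 6.12–6.13; the resulting
   weighted E3-CNF has polynomial size for constant `u`): for every `ε₀ < 1/8` and every rational
   `δ > 0` a `HastadMachine ε₀ δ` (`Hastad3SatReduction.lean`: a string function in `FP` on codes of
   E3-CNFs, satisfiable to satisfiable, value `≤ 7/8 + ε₀` to value `≤ 7/8 + δ`).  Its COMBINATORIAL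
   content is proved in the tree (`Hastad3SatAssembly.lean`, `Hastad3SatDart.lean`,
   `Hastad3SatOfCNF.lean`: exact width `3`, completeness, soundness `7/8 + δ` of the explicit map
   `hastadOfCNF δ`); not yet in the tree is its rendering as a string function in `FP` (under way:
   `HastadPVCoding.lean`, `HastadPVBlockGame.lean`).

So after this file **the single remaining obligation under `hastad_seven_eighths` is the existence of
Håstad machines**, `∀ ε₀ δ : ℚ, ε₀ < 1/8 → 0 < δ → Nonempty (HastadMachine ε₀ δ)`, taken below as an
explicit hypothesis (`hastad_seven_eighths_of_nonempty_hastadMachine`; no named fact is introduced).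
That hypothesis is implied by `hastad_seven_eighths` together with `E3SAT ∈ NP` (apply NP-hardness of
`gapE3SAT δ` to the language `EkSAT 3`: codes of satisfiable E3-CNFs go to codes of satisfiable
E3-CNFs, codes of unsatisfiable ones — in particular those of value `≤ 7/8 + ε₀ < 1` — to codes of
E3-CNFs of value `≤ 7/8 + δ`), so it is not stronger than the printed theorem.

## References

* J. Håstad, *Some optimal inapproximability results*, J. ACM 48 (2001) 798–859: §2 (Def. 2.16–2.17,
  Thm. 2.24, the two-prover protocol and parallel repetition), §6.1 (Test `F3S^δ(u)`,
  Lemmas 6.12–6.13), Thm. 6.5. [Hastad2001]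
* R. Raz, *A parallel repetition theorem*, SIAM J. Comput. 27 (1998) 763–803, Thm. 1.1. [Raz1998]
* S. Arora, B. Barak, *Computational Complexity: A Modern Approach*, CUP 2009, Thm. 11.5, Thm. 11.9,
  §22.2, Thm. 22.16 and Cor. 22.17. [AroraBarakCC2009]
-/

namespace Literature.Computability.Complexity

open _root_.Computability

/-- **The PCP theorem in gap-E3SAT form, PROVED**: for some rational `ε₀ < 1/8` the promise problem
`gapE3SAT ε₀` (satisfiable E3-CNFs vs. E3-CNFs of value `≤ 7/8 + ε₀`) is NP-hard — Håstad 2001,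
Thm. 2.24 without the `E3-CNF-5` regularity; Arora–Barak 2009, Thm. 11.9 ("there exists `ρ < 1` such
that `ρ`-GAP 3SAT is NP-hard") in the E3 form of §22.2.  Witness: `ε₀ = 1/8 - ε₁Q ggP`, from the
tree's gap machine `GapPV.ggMachine` (Dinur's proof, `ApproximationProofs.lean`) through
`gapE3SAT_isNPHard_of_gapMachine` (`GapAssembly.lean`).
[cite: AroraBarakCC2009, Thm. 11.9 and §22.2] [cite: Hastad2001, Thm. 2.24] -/
theorem gapE3SAT_isNPHard_some : ∃ ε₀ : ℚ, ε₀ < 1 / 8 ∧ (gapE3SAT ε₀).IsNPHard :=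
  ⟨1 / 8 - GapPV.ε₁Q GabberGalil.ggP, by linarith [GapPV.ε₁Q_pos GabberGalil.ggP],
    gapE3SAT_isNPHard_of_gapMachine GapPV.ggMachine (GapPV.ε₁Q_le _)⟩

/-- **NP-hardness of `gapE3SAT` at the explicit gap `1/8 - ε₁Q ggP` of Dinur's reduction** (the
witness of `gapE3SAT_isNPHard_some`, kept explicit for machines that start from this particular gap).
[cite: AroraBarakCC2009, Thm. 11.9 and §22.2] -/
theorem gapE3SAT_isNPHard_dinurGap :
    (gapE3SAT (1 / 8 - GapPV.ε₁Q GabberGalil.ggP)).IsNPHard :=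
  gapE3SAT_isNPHard_of_gapMachine GapPV.ggMachine (GapPV.ε₁Q_le _)

/-- **`hastad_seven_eighths` from Håstad machines alone.** GIVEN, for every rational `ε₀ < 1/8` and
`δ > 0`, a Håstad machine from gap `ε₀` to gap `δ` (the proof of Håstad 2001, Thm. 6.5: parallel
repetition of the two-prover protocol, §2 with Raz 1998 Thm. 1.1, and the test `F3S^δ(u)`, §6.1,
Lemmas 6.12–6.13, rendered in `FP`), Håstad's `7/8 + ε` theorem holds: take the `ε₀ < 1/8` of
`gapE3SAT_isNPHard_some` (the PCP theorem in gap form, proved) and transport NP-hardness along the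
machines (`hastad_seven_eighths_of_machines`).  The hypothesis is inline, not a named fact; it is the
single remaining obligation under `hastad_seven_eighths` (module docstring).
[cite: Hastad2001, Thm. 6.5 (proof: §2 Thm. 2.24 with parallel repetition; §6.1, Lemmas 6.12–6.13)]
[cite: Raz1998, Thm. 1.1] -/
theorem hastad_seven_eighths_of_nonempty_hastadMachine
    (hM : ∀ (ε₀ δ : ℚ), ε₀ < 1 / 8 → 0 < δ → Nonempty (HastadMachine ε₀ δ)) :
    hastad_seven_eighths := by
  obtain ⟨ε₀, hε₀, h₀⟩ := gapE3SAT_isNPHard_some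
  exact hastad_seven_eighths_of_machines h₀ fun δ hδ => (hM ε₀ δ hε₀ hδ).some

/-- **`hastad_seven_eighths` from Håstad machines out of Dinur's gap only**: machines from the one gap
`1/8 - ε₁Q ggP` to every `δ > 0` suffice (`gapE3SAT_isNPHard_dinurGap`).
[cite: Hastad2001, Thm. 6.5] [cite: AroraBarakCC2009, Thm. 11.9] -/
theorem hastad_seven_eighths_of_hastadMachine_dinurGap
    (M : ∀ δ : ℚ, 0 < δ → HastadMachine (1 / 8 - GapPV.ε₁Q GabberGalil.ggP) δ) :
    hastad_seven_eighths :=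
  hastad_seven_eighths_of_machines gapE3SAT_isNPHard_dinurGap M

/-- **E3SAT is NP-hard** (as the language `EkSAT 3` of codes of satisfiable E3-CNFs): every `L ∈ NP`
Karp-reduces to the yes-side of the NP-hard promise problem `gapE3SAT ε₀` (`gapE3SAT_isNPHard_some`,
the PCP theorem in gap form) by a map sending non-members to its no-side, which is disjoint from the
yes-side (`gapE3SAT_disjoint_holds`, `ε₀ < 1/8`).  (The classical route is the padding of `3SAT`;
here the gap form already in the tree is reused.) [cite: Hastad2001, §2 (E3-SAT)] [cite: AroraBarakCC2009, Thm. 2.10 and §11.3.1] -/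
theorem EkSAT_three_isNPHard : IsNPHard (EkSAT 3) := by
  obtain ⟨ε₀, hε₀, hhard⟩ := gapE3SAT_isNPHard_some
  intro L hL
  obtain ⟨f, hf, hy, hn⟩ := hhard L hL
  refine ⟨f, hf, fun x => ⟨fun hx => hy hx, fun hfx => ?_⟩⟩
  by_contra hx
  exact Set.disjoint_left.1 (gapE3SAT_disjoint_holds ε₀ hε₀) hfx (hn hx)

end Literature.Computability.Complexity
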